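import Summits.CriticalPhenomena.PercolationContinuityZ3.Theorems.PercNearOneGluingNoHeavyLowerTailCILScaledReferenceTools
import HarnessLib

/-!
# `NoHeavyLowerTail` (stmt-CriticalPhenomena-4575) — the SCALED-REFERENCE theorem: a witness dominating the ports of
# the observer at LOWER attachment weights stays valid when the attachment weights are raised

Support file (prover `prim-hp-3`, hull-port line; `--supports stmt-CriticalPhenomena-4575`).  No definitions, no named
facts, no sorries.

Notation: `μ_w = prodBernoulli w` on `Fin n`, relays `A`, observer `o ∉ A`, level `j`, `π(x) = {z ∈ A : x ↔ z}`,
`I_w(x) = μ_w{|π(x)| ≤ j}` (LIGHTNESS), `bad_w(o) = μ_w{1 ≤ |π(o)| ≤ j}`; a relay `q` is a VALID CIL WITNESS at `w` when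
`bad_w(o) ≤ I_w(q)` (the cumulative isolation lemma `stub_cumulativeIsolation` asks for one valid witness; it closes the crux
by `Theorems.noHeavyLowerTail_of_stub_cumulativeIsolation`).

**Theorem (`HullPort.valid_of_valid_dominating_below`).**  Let `p₀, …, p_{d−1} ∈ A` be relays (injective), `o ∉ A`,
`q ∈ A`, and let `w ≤ w'` be two weight functions that differ only on the pairs `s(o, p_l)`, with
`w s(o,p_l) ≤ w' s(o,p_l)`.  If at the LOWER weights `w` the witness `q` is valid (`bad_w(o) ≤ I_w(q)`) and dominates the
raised ports (`I_w(p_l) ≤ I_w(q)` for all `l`), then `q` is valid at `w'`: `bad_{w'}(o) ≤ I_{w'}(q)`.  The observer is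
arbitrary (non-relay neighbours allowed; their pairs are not touched).

**Corollary (`HullPort.cil_of_portDomination_scaled`).**  For an observer all of whose positive-weight neighbours are relays
(ports `p_l`), a relay `b` dominating every port in ANY reference `w_ref` obtained from `w` by lowering the pairs at `o`
(`w_ref s(o,·) ≤ w s(o,·)`, equal elsewhere) is a valid witness at `w`.  The two extreme references `w_ref = w − o` (all
pairs at `o` deleted; `Theorems.cil_relayNeighbours_port`, van den Berg–Häggström–Kahn) and `w_ref = w`
(`Theorems.cil_of_portDomination`) were the known cases; every intermediate, edge-by-edge scaled reference is new (the
"scaled o-edges" reference of the lead's census LEAD-GEN1.md §1, 0 violations / 9.6·10⁶, is now a theorem for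
relay-neighboured observers).  Domination is NOT monotone in the reference (own census: it is lost in ≈ 4 % of cases when a
reference is raised or lowered), so the corollary does not follow from the two extreme cases.

Proof.  `Φ(w) = bad_w(o) − I_w(q)` is affine in each coordinate (one-bond decomposition `stub_oneBondDecomp_k15`), so
`Φ(w')` is an iterated convex combination of the values of `Φ` at the CORNERS `w^S` (`S` a set of raised pairs put to
weight `1`, the others kept at `w`).  At the empty corner `Φ(w) ≤ 0` is the hypothesis.  At a corner `S ∋ s(o,p_i)` the
observer is a.s. glued to the relay `p_i`, so `bad = I(p_i)` and `Φ(w^S) = I_{w^S}(p_i) − I_{w^S}(q) ≤ 0`: the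
comparison `I(p_i) ≤ I(q)` survives raising `s(o,p_i)` (a pair AT `p_i`) and then raising the other pairs of `S` (pairs AT
`o`, which is then a.s. in the cluster of `p_i`) by the glued comparison `CutObserver.lightness_glued_le`
(BHK two-cluster exchange) combined with affinity in the raised coordinate (`HullPort.lightness_le_of_raise_own_edge`:
raising a pair at the LOSER of a lightness comparison preserves the comparison, from any starting weight).
-/

noncomputable section

namespace Summit.CriticalPhenomena.PercolationContinuityZ3.Theorems

open MeasureTheory Set Literature.Probability.LatticeModels Literature.Probability.Percolation
open scoped Classical BigOperators

variable {n : ℕ}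

namespace HullPort

/-! ### Multi-affine interpolation -/

/-- **Multi-affine interpolation.**  Let `Φ(w) = μ_w(X) − μ_w(Y)` for two fixed events.  Let `w ≤ w'` differ only on the
finite set of pairs `E` (`w e ≤ w' e` there, equal elsewhere).  If `Φ ≤ 0` at every CORNER `w^S` (`S ⊆ E` raised to
weight `1`, the rest kept at `w`), then `Φ(w') ≤ 0`: `Φ` is affine in each coordinate, so `Φ(w')` is an iterated convex
combination of corner values. [folklore] -/
theorem interp_nonpos (X Y : Set (BondConfig (Fin n))) (E : Finset (Sym2 (Fin n))) :
    ∀ w w' : Sym2 (Fin n) → unitInterval,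
      (∀ e, e ∉ E → w' e = w e) → (∀ e ∈ E, (w e : ℝ) ≤ w' e) →
      (∀ S, S ⊆ E →
        (prodBernoulli (fun e' => if e' ∈ S then (1 : unitInterval) else w e')).real X -
          (prodBernoulli (fun e' => if e' ∈ S then (1 : unitInterval) else w e')).real Y ≤ 0) →
      (prodBernoulli w').real X - (prodBernoulli w').real Y ≤ 0 := by
  induction E using Finset.induction_on with
  | empty =>
    intro w w' hagree _ hcorner
    have hww : w' = w := funext fun e => hagree e (Finset.notMem_empty e)
    have h := hcorner ∅ subset_rfl
    rw [corner_empty] at h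
    rw [hww]
    exact h
  | insert e E₀ heE₀ ih =>
    intro w w' hagree hle hcorner
    set t : unitInterval := w e with ht
    set u : unitInterval := w' e with hu
    have htu : (t : ℝ) ≤ u := hle e (Finset.mem_insert_self e E₀)
    -- the point with `e` lowered back to `w e`
    have hlow : (prodBernoulli (Function.update w' e t)).real X - (prodBernoulli (Function.update w' e t)).real Y ≤ 0 := by
      apply ih w (Function.update w' e t)
      · intro e' he'
        by_cases h : e' = e
        · subst h; simp [ht]
        · rw [Function.update_of_ne h]
          exact hagree e' (by simp [h, he'])
      · intro e' he'
        have h : e' ≠ e := fun h => heE₀ (h ▸ he')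
        rw [Function.update_of_ne h]
        exact hle e' (Finset.mem_insert_of_mem he')
      · intro S hS
        exact hcorner S (hS.trans (Finset.subset_insert e E₀))
    -- the point with `e` raised to `1`, relative to the base `w[e ↦ 1]`
    have hhigh : (prodBernoulli (Function.update w' e 1)).real X - (prodBernoulli (Function.update w' e 1)).real Y ≤ 0 := by
      apply ih (Function.update w e 1) (Function.update w' e 1)
      · intro e' he'
        by_cases h : e' = e
        · subst h; simp
        · rw [Function.update_of_ne h, Function.update_of_ne h]
          exact hagree e' (by simp [h, he'])
      · intro e' he'
        have h : e' ≠ e := fun h => heE₀ (h ▸ he')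
        rw [Function.update_of_ne h, Function.update_of_ne h]
        exact hle e' (Finset.mem_insert_of_mem he')
      · intro S hS
        have hcor : (fun e' => if e' ∈ S then (1 : unitInterval) else Function.update w e 1 e') =
            (fun e' => if e' ∈ insert e S then (1 : unitInterval) else w e') := by
          funext e'
          by_cases h : e' = e
          · subst h; simp
          · rw [Function.update_of_ne h]
            simp [Finset.mem_insert, h]
        rw [hcor]
        exact hcorner (insert e S) (Finset.insert_subset_insert e hS)
    -- affinity in the coordinate `e`
    have hX := real_update_affine w' e u X
    have hY := real_update_affine w' e u Y
    have hXt := real_update_affine w' e t X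
    have hYt := real_update_affine w' e t Y
    have hself : Function.update w' e u = w' := by rw [hu]; exact Function.update_eq_self e w'
    rw [hself] at hX hY
    rw [hXt, hYt] at hlow
    have key := affine_nonpos_of_le
      (f₀ := (prodBernoulli (Function.update w' e 0)).real X - (prodBernoulli (Function.update w' e 0)).real Y)
      (f₁ := (prodBernoulli (Function.update w' e 1)).real X - (prodBernoulli (Function.update w' e 1)).real Y)
      htu u.2.2 (by linarith) hhigh
    rw [hX, hY]
    linarith

/-! ### The scaled-reference theorem -/

/-- **Validity propagates upward in the observer's relay pairs from a domination point.**  Let `o ≠ q`, relays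
`p₀, …, p_{d−1} ∈ A` all different from `o`, and `w ≤ w'` two weight functions differing only on the pairs `s(o, p_l)`,
with `w s(o,p_l) ≤ w' s(o,p_l)`.  If at `w` the witness `q` is valid (`bad_w(o) ≤ I_w(q)`) and dominates every `p_l`
(`I_w(p_l) ≤ I_w(q)`), then `q` is valid at `w'`: `bad_{w'}(o) ≤ I_{w'}(q)`.  The observer may have non-relay
neighbours (their pairs are simply not among the raised ones). [this file; cite: VandenbergHaggstromKahn2005, Thm. 1.5] -/
theorem valid_of_valid_dominating_below (w w' : Sym2 (Fin n) → unitInterval) (A : Finset (Fin n)) (o q : Fin n)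
    (j : ℕ) {d : ℕ} (p : Fin d → Fin n) (hpA : ∀ l, p l ∈ A) (hoA : o ∉ A) (hoq : o ≠ q)
    (hagree : ∀ e, (∀ l, e ≠ s(o, p l)) → w' e = w e) (hle : ∀ l, (w s(o, p l) : ℝ) ≤ w' s(o, p l))
    (hvalid : (prodBernoulli w).real {ω : BondConfig (Fin n) |
        1 ≤ (A.filter fun z => ω ∈ openConn o z).card ∧ (A.filter fun z => ω ∈ openConn o z).card ≤ j} ≤
      (prodBernoulli w).real {ω : BondConfig (Fin n) | (A.filter fun z => ω ∈ openConn q z).card ≤ j})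
    (hdom : ∀ l,
      (prodBernoulli w).real {ω : BondConfig (Fin n) | (A.filter fun z => ω ∈ openConn (p l) z).card ≤ j} ≤
        (prodBernoulli w).real {ω : BondConfig (Fin n) | (A.filter fun z => ω ∈ openConn q z).card ≤ j}) :
    (prodBernoulli w').real {ω : BondConfig (Fin n) |
        1 ≤ (A.filter fun z => ω ∈ openConn o z).card ∧ (A.filter fun z => ω ∈ openConn o z).card ≤ j} ≤
      (prodBernoulli w').real {ω : BondConfig (Fin n) | (A.filter fun z => ω ∈ openConn q z).card ≤ j} := by
  set L := {ω : BondConfig (Fin n) |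
      1 ≤ (A.filter fun z => ω ∈ openConn o z).card ∧ (A.filter fun z => ω ∈ openConn o z).card ≤ j} with hL
  set Rq := {ω : BondConfig (Fin n) | (A.filter fun z => ω ∈ openConn q z).card ≤ j} with hRq
  set E : Finset (Sym2 (Fin n)) := Finset.univ.image fun l => s(o, p l) with hE
  suffices h : (prodBernoulli w').real L - (prodBernoulli w').real Rq ≤ 0 by linarith
  apply interp_nonpos L Rq E w w'
  · intro e he
    apply hagree e
    intro l hl
    exact he (hl ▸ Finset.mem_image_of_mem _ (Finset.mem_univ l))
  · intro e he
    obtain ⟨l, -, hl⟩ := Finset.mem_image.mp he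
    rw [← hl]
    exact hle l
  · intro S hS
    by_cases hSe : S = ∅
    · subst hSe
      rw [corner_empty]
      linarith
    · obtain ⟨e₀, he₀⟩ := Finset.nonempty_iff_ne_empty.mpr hSe
      obtain ⟨i, -, hi⟩ := Finset.mem_image.mp (hS he₀)
      have hopi : o ≠ p i := fun h => hoA (h ▸ hpA i)
      set wS : Sym2 (Fin n) → unitInterval := fun e' => if e' ∈ S then (1 : unitInterval) else w e' with hwS
      have hwSe₀ : wS s(o, p i) = 1 := by simp [hwS, hi, he₀]
      have hbad : (prodBernoulli wS).real L =
          (prodBernoulli wS).real {ω : BondConfig (Fin n) | (A.filter fun z => ω ∈ openConn (p i) z).card ≤ j} :=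
        bad_eq_lightness_of_weight_one wS A hopi (hpA i) j hwSe₀
      have hdomS : (prodBernoulli wS).real {ω : BondConfig (Fin n) | (A.filter fun z => ω ∈ openConn (p i) z).card ≤ j} ≤
          (prodBernoulli wS).real Rq := by
        by_cases hqpi : q = p i
        · rw [hRq, hqpi]
        · have hSform : ∀ e ∈ S, ∃ v, v ≠ o ∧ e = s(o, v) := by
            intro e he
            obtain ⟨l, -, hl⟩ := Finset.mem_image.mp (hS he)
            exact ⟨p l, fun h => hoA (h ▸ hpA l), hl.symm⟩
          exact corner_domination w A o q (p i) j hoq hopi hqpi S hSform (hi ▸ he₀) (hdom i)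
      rw [hbad]
      linarith

/-- **Scaled-reference CIL for relay-neighboured observers.**  Let `o ∉ A` be an observer all of whose positive-weight
neighbours are among the relays `p₀, …, p_{d−1}` (`p` injective, `d ≥ 1`), in a weighted graph `w` that is otherwise
arbitrary.  Let `w_ref` be ANY reference obtained from `w` by lowering the pairs at `o` (`w_ref s(o,v) ≤ w s(o,v)` for all
`v`, `w_ref = w` on pairs not containing `o`).  If a relay `b ∈ A` dominates every port in the reference,
`I_{w_ref}(p_l) ≤ I_{w_ref}(b)`, then `b` is a valid CIL witness at `w`: `μ_w{1 ≤ N ≤ j} ≤ μ_w{|π(b)| ≤ j}`.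
The references `w_ref = w − o` (`Theorems.cil_relayNeighbours_port`) and `w_ref = w` (`Theorems.cil_of_portDomination`)
are the previously known extreme cases. [this file; cite: VandenbergHaggstromKahn2005, Thm. 1.5] -/
theorem cil_of_portDomination_scaled (w wr : Sym2 (Fin n) → unitInterval) (A : Finset (Fin n)) (o : Fin n) (j : ℕ)
    {d : ℕ} (p : Fin d → Fin n) (hp : Function.Injective p) (hpA : ∀ l, p l ∈ A) (hoA : o ∉ A) (hd : 0 < d)
    (hobs : ∀ v, w s(o, v) ≠ 0 → ∃ l, v = p l)
    (hagree : ∀ e : Sym2 (Fin n), o ∉ e → wr e = w e) (hlower : ∀ v, (wr s(o, v) : ℝ) ≤ w s(o, v))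
    (b : Fin n) (hbA : b ∈ A)
    (hdom : ∀ l : Fin d,
      (prodBernoulli wr).real {ω : BondConfig (Fin n) | (A.filter fun x => ω ∈ openConn (p l) x).card ≤ j} ≤
        (prodBernoulli wr).real {ω : BondConfig (Fin n) | (A.filter fun x => ω ∈ openConn b x).card ≤ j}) :
    (prodBernoulli w).real {ω : BondConfig (Fin n) |
        1 ≤ (A.filter fun x => ω ∈ openConn o x).card ∧ (A.filter fun x => ω ∈ openConn o x).card ≤ j} ≤
      (prodBernoulli w).real {ω : BondConfig (Fin n) | (A.filter fun x => ω ∈ openConn b x).card ≤ j} := by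
  -- the reference is relay-neighboured as well
  have hobs_r : ∀ v, wr s(o, v) ≠ 0 → ∃ l, v = p l := by
    intro v hv
    apply hobs v
    intro h0
    apply hv
    have h1 : (wr s(o, v) : ℝ) ≤ 0 := by
      have := hlower v
      rw [h0] at this
      simpa using this
    have h2 : (wr s(o, v) : ℝ) = 0 := le_antisymm h1 (wr s(o, v)).2.1
    exact Subtype.ext (by simp [h2])
  -- validity at the reference (`cil_of_portDomination`, reference = the graph itself)
  have hvalid := cil_of_portDomination wr A o j p hp hpA hoA hd hobs_r b hdom
  have hob : o ≠ b := fun h => hoA (h ▸ hbA)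
  refine valid_of_valid_dominating_below wr w A o b j p hpA hoA hob ?_ (fun l => hlower (p l)) hvalid hdom
  -- `w` and `wr` agree off the port pairs at `o`
  intro e he
  by_cases hoe : o ∈ e
  · obtain ⟨v, hv⟩ := Sym2.mem_iff_exists.mp hoe
    rw [hv]
    by_cases hwv : w s(o, v) = 0
    · have h1 : (wr s(o, v) : ℝ) ≤ 0 := by
        have := hlower v
        rw [hwv] at this
        simpa using this
      have h2 : (wr s(o, v) : ℝ) = 0 := le_antisymm h1 (wr s(o, v)).2.1
      have h3 : wr s(o, v) = 0 := Subtype.ext (by simp [h2])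
      rw [hwv, h3]
    · obtain ⟨l, hl⟩ := hobs v hwv
      exact absurd (hl ▸ hv) (he l)
  · exact (hagree e hoe).symm

end HullPort

end Summit.CriticalPhenomena.PercolationContinuityZ3.Theorems

end
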